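import Summits.QuantumAdvantage.AdviceFreeQNC0.LowDegreeResidueAvoidance
import HarnessLib

/-!
# Cell qa-qnc0 (rung F-Q1, route RingFrame): the window propagation bound behind residue avoidance, at a general scale

`LowDegreeResidueAvoidance.lean` proves that a low-degree `𝔽₂`-polynomial whose support avoids one
residue class of the Hamming weight mod `3` is sparse, by propagating sparsity from the class-`r`
layers to their partners `m = k ± q` with Srinivasan's robust Hegedűs lemma (Srinivasan 2023,
Lemma 3.1; tree theorem `Hegedus.nzFrac_lt_of_lowDeg`) at the scale `q ≈ √(λn)`.  The argument
itself never uses that particular scale: it needs only a power of two `q` with `256q ≤ n`, a degree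
`d < c_H·q`, and two real parameters `Λa, Λb` with `Λb·n < q² ≤ 16Λa·n` that drive the thresholds of
Lemma 3.1 in the middle half (`threshold_a`, `threshold_b`).

This file isolates that argument as ONE reusable inequality (`card_support_le_window_scale`):

  `#supp g ≤ n·2ⁿ/(4q²) + η·2ⁿ + εB·2ⁿ + (ρ/εA)·2η·2ⁿ`

whenever `#(supp g ∩ {|u| ≡ r}) ≤ η·2ⁿ`, `εA ≤ min(e^{−6400Λa}, 1/1000)`, `e^{−Λb/50} ≤ εB` and
`e^{32q²/n} ≤ ρ` — the four terms being the Chebyshev tail outside the window `|2m − n| < 2q`, the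
class-`r` window layers, the window layers with a sparse partner (Lemma 3.1), and the window layers
with a dense partner (comparison of near-middle binomial coefficients).  The linear-scale instance
`q ≈ n/L` (planner qa-qnc0-p1 gen 12, ROUND-11 §1.4, statement `SparseAvoidLinear` of Sketch12) is
`SparseAvoidanceLinear.lean`; the `√n`-scale instance is the landed `card_support_le_of_sparse_residue_class`
(not re-derived).  WHAT THIS IS NOT: nothing on crux α (`RingToElim`); no separation; bookkeeping only.

## References

* S. Srinivasan, *A robust version of Hegedűs's lemma, with applications*, TheoretiCS 2 (2023),
  article 5, Lemma 3.1 [Srinivasan2023].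
-/

noncomputable section

namespace Summit.QuantumAdvantage.AdviceFreeQNC0

open Finset
open Literature.Computability.MetaComplexity Literature.Computability.MetaComplexity.Smolensky
open Literature.Computability.MetaComplexity.Hegedus


variable {n : ℕ}

/-- **Window propagation bound at a general scale.**  Let `F` have characteristic `2` and satisfy the
robust Hegedűs shape `hfact` (the body of `Hegedus.nzFrac_lt_of_lowDeg` at `p = 2`) with
constants `c_H, n_H`; let `n ≥ n_H`, `q = 2^j` with `256q ≤ n`, `d < c_H·q`,
and real parameters with `q² ≤ 16Λa·n`, `Λb·n < q²`, `0 < εA ≤ min(e^{−6400Λa}, 1/1000)`,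
`e^{−Λb/50} ≤ εB`, `e^{8(2q)²/n} ≤ ρ`.  If `g ∈ lowDeg F n d` has `#(supp g ∩ {|u| ≡ r (3)}) ≤ η·2ⁿ`, then
`#supp g ≤ n·2ⁿ/(4q²) + η·2ⁿ + εB·2ⁿ + (ρ/εA)·(2η·2ⁿ)`.
(Tail by Chebyshev; class-`r` window layers by hypothesis; a window layer `m ≢ r` has a partner
`k = m ± q ≡ r` in the middle half: if layer `k` is `εA`-sparse, Lemma 3.1 makes layer `m` `εB`-sparse,
otherwise `C(n,m) ≤ ρ·C(n,k) < (ρ/εA)·N_k` and each `k` serves at most two `m`.)  The cell's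
bookkeeping (qa-qnc0 TARGET §11.3), scale-free form. [cite: Srinivasan2023, Lemma 3.1] -/
theorem card_support_le_window_scale (F : Type) [Field F] [DecidableEq F]
    {cH : ℝ} {nH : ℕ}
    (hfact : ∀ n : ℕ, nH ≤ n → ∀ k q d : ℕ, (∃ j : ℕ, q = 2 ^ j) → 100 * q < k → k + 100 * q < n →
      (d : ℝ) < cH * q → ∀ P : CubeFn F n, P ∈ lowDeg F n d →
        nzFrac P k ≤ min (Real.exp (-(100 * (q : ℝ) ^ 2 / (n * alphaOf n k)))) (1 / 1000) →
        nzFrac P (k + q) < Real.exp (-((q : ℝ) ^ 2 / (100 * n * alphaOf n k))) ∧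
          nzFrac P (k - q) < Real.exp (-((q : ℝ) ^ 2 / (100 * n * alphaOf n k))))
    {n q j d : ℕ} (r : ℕ)
    (hnH : nH ≤ n) (hq : q = 2 ^ j) (h256 : 256 * q ≤ n) (hdq : (d : ℝ) < cH * q)
    {Λa Λb εA εB ρ η : ℝ}
    (hqq_leR : (q : ℝ) ^ 2 ≤ 16 * (Λa * n)) (hLn_ltR : Λb * n < (q : ℝ) ^ 2)
    (hεApos : 0 < εA) (hεAexp : εA ≤ Real.exp (-(6400 * Λa))) (hεAle : εA ≤ 1 / 1000)
    (hεB : Real.exp (-(Λb / 50)) ≤ εB)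
    (hρ : Real.exp (8 * ((2 * q : ℕ) : ℝ) ^ 2 / n) ≤ ρ)
    (g : CubeFn F n) (hg : g ∈ lowDeg F n d)
    (hSr : ((univ.filter fun u : Fin n → Bool => g u ≠ 0 ∧ wt u % 3 = r % 3).card : ℝ) ≤
      η * (2 : ℝ) ^ n) :
    ((univ.filter fun u : Fin n → Bool => g u ≠ 0).card : ℝ) ≤
      n * (2 : ℝ) ^ n / (4 * (q : ℝ) ^ 2) + η * (2 : ℝ) ^ n + εB * (2 : ℝ) ^ n +
        ρ / εA * (2 * (η * (2 : ℝ) ^ n)) := by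
  classical
  have hqpos : 0 < q := by rw [hq]; positivity
  have hn0 : 0 < n := by omega
  have hnR : (0 : ℝ) < n := by exact_mod_cast hn0
  have hq3 : q % 3 ≠ 0 := by rw [hq]; exact two_pow_mod_three_ne_zero j
  have hqR : (0 : ℝ) < q := by exact_mod_cast hqpos
  have hρpos : 0 < ρ := lt_of_lt_of_le (Real.exp_pos _) hρ
  have hεBpos : 0 < εB := lt_of_lt_of_le (Real.exp_pos _) hεB
  /- layer sums: `N m = #{u ∈ layer m : g u ≠ 0}` -/
  obtain ⟨N, hN⟩ : ∃ N : ℕ → ℕ, N = fun m => ((layer n m).filter fun u => g u ≠ 0).card :=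
    ⟨_, rfl⟩
  have hNm : ∀ m, ((layer n m).filter fun u => g u ≠ 0).card = N m := fun m => by rw [hN]
  rw [card_filter_ne_zero_mod_eq_sum] at hSr
  rw [card_filter_ne_zero_eq_sum]
  simp only [hNm] at hSr ⊢
  push_cast at hSr ⊢
  have hN_le_C : ∀ m, (N m : ℝ) ≤ n.choose m := fun m => by
    rw [← hNm]; exact_mod_cast card_filter_layer_le_choose g m
  have hN_eq : ∀ {m}, m ≤ n → (N m : ℝ) = nzFrac g m * n.choose m := fun hm => by
    rw [← hNm]; exact card_filter_layer_eq_nzFrac_mul g hm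
  have hN_nonneg : ∀ m, (0 : ℝ) ≤ N m := fun m => Nat.cast_nonneg _
  have hsumC : ∑ m ∈ range (n + 1), (n.choose m : ℝ) = (2 : ℝ) ^ n := sum_range_choose_real n
  have h2n : (0 : ℝ) < (2 : ℝ) ^ n := by positivity
  /- (i) the tail: layers with `|2m - n| ≥ 2q` carry at most `n·2ⁿ/(4q²)` points -/
  have htail : ∑ m ∈ (range (n + 1)).filter (fun m => ¬(n < 2 * m + 2 * q ∧ 2 * m < n + 2 * q)),
      (N m : ℝ) ≤ n * (2 : ℝ) ^ n / (4 * (q : ℝ) ^ 2) :=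
    le_trans (sum_le_sum fun m _ => hN_le_C m) (sum_choose_not_window_le n q hqpos)
  /- (ii) window layers of the class `r` itself: at most `η·2ⁿ` points by hypothesis -/
  have hWr : ∑ m ∈ ((range (n + 1)).filter (fun m => n < 2 * m + 2 * q ∧ 2 * m < n + 2 * q)).filter
      (fun m => m % 3 = r % 3), (N m : ℝ) ≤ η * (2 : ℝ) ^ n := by
    refine le_trans (sum_le_sum_of_subset_of_nonneg ?_ fun m _ _ => hN_nonneg m) hSr
    intro m hm
    simp only [mem_filter] at hm ⊢
    exact ⟨hm.1.1, hm.2⟩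
  /- the partner `k(m) ∈ {m - q, m + q}` with `k ≡ r (mod 3)` of a window layer `m ≢ r` -/
  obtain ⟨kf, hkf⟩ : ∃ kf : ℕ → ℕ, kf = fun m => if (m + q) % 3 = r % 3 then m + q else m - q :=
    ⟨_, rfl⟩
  have hk : ∀ m, m < n + 1 → (n < 2 * m + 2 * q ∧ 2 * m < n + 2 * q) → m % 3 ≠ r % 3 →
      kf m % 3 = r % 3 ∧ 100 * q < kf m ∧ kf m + 100 * q < n ∧ n ≤ 4 * kf m ∧ 4 * kf m ≤ 3 * n ∧
      n / 2 ≤ kf m + 2 * q ∧ kf m ≤ n - n / 2 + 2 * q ∧ kf m ≤ n ∧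
      ((kf m = m + q ∧ (m + q) % 3 = r % 3) ∨ (kf m = m - q ∧ q ≤ m ∧ (m + q) % 3 ≠ r % 3)) :=
    fun m hm hw hne => partner_facts h256 hq3 hm hw hne (congrFun hkf m)
  obtain ⟨A, hA⟩ : ∃ A : Finset ℕ, A = ((range (n + 1)).filter
      (fun m => n < 2 * m + 2 * q ∧ 2 * m < n + 2 * q)).filter (fun m => ¬(m % 3 = r % 3)) :=
    ⟨_, rfl⟩
  have hAmem : ∀ m ∈ A, m < n + 1 ∧ (n < 2 * m + 2 * q ∧ 2 * m < n + 2 * q) ∧ m % 3 ≠ r % 3 := by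
    intro m hm
    simp only [hA, mem_filter, mem_range] at hm
    exact ⟨hm.1.1, hm.1.2, hm.2⟩
  /- threshold comparisons for layers `k` in the middle half (`α(n,k) ∈ [1/4, 1/2]`) -/
  have hthrA : ∀ k, n ≤ 4 * k → 4 * k ≤ 3 * n →
      εA ≤ min (Real.exp (-(100 * (q : ℝ) ^ 2 / (n * alphaOf n k)))) (1 / 1000) :=
    fun k h1 h2 => threshold_a hn0 h1 h2 hqq_leR hεAexp hεAle
  have hthrB : ∀ k, n ≤ 4 * k → 4 * k ≤ 3 * n →
      Real.exp (-((q : ℝ) ^ 2 / (100 * n * alphaOf n k))) ≤ εB :=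
    fun k h1 h2 => (threshold_b hn0 h1 h2 hLn_ltR).trans hεB
  /- (iii) good partners: layer `k(m)` is `εA`-sparse, so Lemma 3.1 makes layer `m` `εB`-sparse -/
  have hgood : ∀ m ∈ A, nzFrac g (kf m) ≤ εA → (N m : ℝ) ≤ εB * n.choose m := by
    intro m hm hGd
    obtain ⟨hm1, hw, hne⟩ := hAmem m hm
    obtain ⟨hk3, hk100, hk100', hk4, hk4', hkw1, hkw2, hkn, hkm⟩ := hk m hm1 hw hne
    have hA' := le_trans hGd (hthrA (kf m) hk4 hk4')
    have hres := hfact n hnH (kf m) q d ⟨j, hq⟩ hk100 hk100' hdq g hg hA'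
    have hB := hthrB (kf m) hk4 hk4'
    have hmle : m ≤ n := by omega
    rw [hN_eq hmle]
    refine mul_le_mul_of_nonneg_right ?_ (Nat.cast_nonneg _)
    rcases hkm with ⟨hke, _⟩ | ⟨hke, hqm, _⟩
    · have e : m = kf m - q := by omega
      rw [e]
      exact (hres.2.trans_le hB).le
    · have e : m = kf m + q := by omega
      rw [e]
      exact (hres.1.trans_le hB).le
  /- (iv) bad partners: layer `k(m)` itself carries `> εA·C(n,k) ≥ (εA/ρ)·C(n,m)` points -/
  have hbad : ∀ m ∈ A, ¬(nzFrac g (kf m) ≤ εA) →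
      (N m : ℝ) ≤ ρ / εA * N (kf m) := by
    intro m hm hGd
    rw [not_le] at hGd
    obtain ⟨hm1, hw, hne⟩ := hAmem m hm
    obtain ⟨hk3, hk100, hk100', hk4, hk4', hkw1, hkw2, hkn, hkm⟩ := hk m hm1 hw hne
    have h16 : 8 * (2 * q) ≤ n := by omega
    have hC := choose_le_exp_mul_choose h16 (by omega : n / 2 ≤ kf m + 2 * q) (by omega) m
    have hNk : εA * n.choose (kf m) < N (kf m) := by
      rw [hN_eq hkn]
      exact mul_lt_mul_of_pos_right hGd (by exact_mod_cast Nat.choose_pos hkn)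
    have hCk : (0 : ℝ) ≤ n.choose (kf m) := Nat.cast_nonneg _
    calc (N m : ℝ) ≤ n.choose m := hN_le_C m
      _ ≤ Real.exp (8 * ((2 * q : ℕ) : ℝ) ^ 2 / n) * n.choose (kf m) := hC
      _ ≤ ρ * n.choose (kf m) := mul_le_mul_of_nonneg_right hρ hCk
      _ = ρ / εA * (εA * n.choose (kf m)) := by
          rw [← mul_assoc, div_mul_cancel₀ _ hεApos.ne']
      _ ≤ ρ / εA * N (kf m) :=
          mul_le_mul_of_nonneg_left hNk.le (div_nonneg hρpos.le hεApos.le)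
  /- the bad partners are `≡ r (mod 3)` and each is the partner of at most two layers -/
  have hsum_kf : ∑ m ∈ A.filter (fun m => ¬(nzFrac g (kf m) ≤ εA)), (N (kf m) : ℝ) ≤
      2 * (η * (2 : ℝ) ^ n) := by
    obtain ⟨B, hB⟩ : ∃ B : Finset ℕ, B = A.filter (fun m => ¬(nzFrac g (kf m) ≤ εA)) := ⟨_, rfl⟩
    rw [← hB]
    have hBA : B ⊆ A := by rw [hB]; exact filter_subset _ _
    rw [← sum_filter_add_sum_filter_not B (fun m => (m + q) % 3 = r % 3)]
    have hplus : ∑ m ∈ B.filter (fun m => (m + q) % 3 = r % 3), (N (kf m) : ℝ) ≤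
        η * (2 : ℝ) ^ n := by
      have e : ∀ m ∈ B.filter (fun m => (m + q) % 3 = r % 3), (N (kf m) : ℝ) =
          N (m + q) := by
        intro m hm
        rw [mem_filter] at hm
        simp only [hkf, if_pos hm.2]
      rw [sum_congr rfl e]
      have hinj : ∀ x ∈ B.filter (fun m => (m + q) % 3 = r % 3),
          ∀ y ∈ B.filter (fun m => (m + q) % 3 = r % 3), x + q = y + q → x = y := by
        intro x _ y _ h; omega
      have himg : ∑ m ∈ B.filter (fun m => (m + q) % 3 = r % 3), (N (m + q) : ℝ) =
          ∑ k ∈ (B.filter (fun m => (m + q) % 3 = r % 3)).image (fun m => m + q),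
            (N k : ℝ) :=
        (sum_image (f := fun k => (N k : ℝ)) (g := fun m => m + q) hinj).symm
      rw [himg]
      refine le_trans (sum_le_sum_of_subset_of_nonneg ?_ fun k _ _ => hN_nonneg k) hSr
      intro k hk'
      rw [mem_image] at hk'
      obtain ⟨m, hm, rfl⟩ := hk'
      rw [mem_filter] at hm
      obtain ⟨hm1, hw, hne⟩ := hAmem m (hBA hm.1)
      rw [mem_filter, mem_range]
      exact ⟨by omega, hm.2⟩
    have hminus : ∑ m ∈ B.filter (fun m => ¬((m + q) % 3 = r % 3)), (N (kf m) : ℝ) ≤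
        η * (2 : ℝ) ^ n := by
      have e : ∀ m ∈ B.filter (fun m => ¬((m + q) % 3 = r % 3)), (N (kf m) : ℝ) =
          N (m - q) := by
        intro m hm
        rw [mem_filter] at hm
        simp only [hkf, if_neg hm.2]
      rw [sum_congr rfl e]
      have hinj : ∀ x ∈ B.filter (fun m => ¬((m + q) % 3 = r % 3)),
          ∀ y ∈ B.filter (fun m => ¬((m + q) % 3 = r % 3)), x - q = y - q → x = y := by
        intro x hx y hy h
        obtain ⟨hx1, hwx, _⟩ := hAmem x (hBA (mem_filter.1 hx).1)
        obtain ⟨hy1, hwy, _⟩ := hAmem y (hBA (mem_filter.1 hy).1)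
        omega
      have himg : ∑ m ∈ B.filter (fun m => ¬((m + q) % 3 = r % 3)), (N (m - q) : ℝ) =
          ∑ k ∈ (B.filter (fun m => ¬((m + q) % 3 = r % 3))).image (fun m => m - q),
            (N k : ℝ) :=
        (sum_image (f := fun k => (N k : ℝ)) (g := fun m => m - q) hinj).symm
      rw [himg]
      refine le_trans (sum_le_sum_of_subset_of_nonneg ?_ fun k _ _ => hN_nonneg k) hSr
      intro k hk'
      rw [mem_image] at hk'
      obtain ⟨m, hm, rfl⟩ := hk'
      have hm' := mem_filter.1 hm
      obtain ⟨hm1, hw, hne⟩ := hAmem m (hBA hm'.1)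
      obtain ⟨hk3, -, -, -, -, -, -, hkn, hkm⟩ := hk m hm1 hw hne
      rw [mem_filter, mem_range]
      rcases hkm with ⟨_, hc⟩ | ⟨hke, hqm, _⟩
      · exact absurd hc hm'.2
      · rw [← hke]; exact ⟨by omega, hk3⟩
    linarith
  /- assembly -/
  have hsplit1 : ∑ m ∈ (range (n + 1)).filter (fun m => n < 2 * m + 2 * q ∧ 2 * m < n + 2 * q),
        (N m : ℝ) +
      ∑ m ∈ (range (n + 1)).filter (fun m => ¬(n < 2 * m + 2 * q ∧ 2 * m < n + 2 * q)),
        (N m : ℝ) = ∑ m ∈ range (n + 1), (N m : ℝ) :=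
    sum_filter_add_sum_filter_not _ _ _
  have hsplit2 : ∑ m ∈ ((range (n + 1)).filter
        (fun m => n < 2 * m + 2 * q ∧ 2 * m < n + 2 * q)).filter (fun m => m % 3 = r % 3),
        (N m : ℝ) +
      ∑ m ∈ ((range (n + 1)).filter
        (fun m => n < 2 * m + 2 * q ∧ 2 * m < n + 2 * q)).filter (fun m => ¬(m % 3 = r % 3)),
        (N m : ℝ) =
      ∑ m ∈ (range (n + 1)).filter (fun m => n < 2 * m + 2 * q ∧ 2 * m < n + 2 * q),
        (N m : ℝ) :=
    sum_filter_add_sum_filter_not _ _ _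
  have hsplit3 : ∑ m ∈ A.filter (fun m => nzFrac g (kf m) ≤ εA), (N m : ℝ) +
      ∑ m ∈ A.filter (fun m => ¬(nzFrac g (kf m) ≤ εA)), (N m : ℝ) =
      ∑ m ∈ A, (N m : ℝ) :=
    sum_filter_add_sum_filter_not _ _ _
  have hgood_sum : ∑ m ∈ A.filter (fun m => nzFrac g (kf m) ≤ εA), (N m : ℝ) ≤
      εB * (2 : ℝ) ^ n := by
    calc ∑ m ∈ A.filter (fun m => nzFrac g (kf m) ≤ εA), (N m : ℝ)
        ≤ ∑ m ∈ A.filter (fun m => nzFrac g (kf m) ≤ εA), εB * (n.choose m : ℝ) :=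
          sum_le_sum fun m hm => hgood m (mem_filter.1 hm).1 (mem_filter.1 hm).2
      _ ≤ ∑ m ∈ range (n + 1), εB * (n.choose m : ℝ) := by
          apply sum_le_sum_of_subset_of_nonneg
          · intro m hm
            exact mem_range.2 (hAmem m (mem_filter.1 hm).1).1
          · intro m _ _
            exact mul_nonneg hεBpos.le (Nat.cast_nonneg _)
      _ = εB * (2 : ℝ) ^ n := by rw [← mul_sum, hsumC]
  have hbad_sum : ∑ m ∈ A.filter (fun m => ¬(nzFrac g (kf m) ≤ εA)), (N m : ℝ) ≤
      ρ / εA * (2 * (η * (2 : ℝ) ^ n)) := by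
    calc ∑ m ∈ A.filter (fun m => ¬(nzFrac g (kf m) ≤ εA)), (N m : ℝ)
        ≤ ∑ m ∈ A.filter (fun m => ¬(nzFrac g (kf m) ≤ εA)), ρ / εA * (N (kf m) : ℝ) :=
          sum_le_sum fun m hm => hbad m (mem_filter.1 hm).1 (mem_filter.1 hm).2
      _ = ρ / εA * ∑ m ∈ A.filter (fun m => ¬(nzFrac g (kf m) ≤ εA)),
            (N (kf m) : ℝ) := by rw [mul_sum]
      _ ≤ ρ / εA * (2 * (η * (2 : ℝ) ^ n)) :=
          mul_le_mul_of_nonneg_left hsum_kf (div_nonneg hρpos.le hεApos.le)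
  have hA_sum : ∑ m ∈ A, (N m : ℝ) ≤ εB * (2 : ℝ) ^ n + ρ / εA * (2 * (η * (2 : ℝ) ^ n)) := by
    rw [← hsplit3]; linarith
  have hA_eq : ∑ m ∈ ((range (n + 1)).filter
      (fun m => n < 2 * m + 2 * q ∧ 2 * m < n + 2 * q)).filter (fun m => ¬(m % 3 = r % 3)),
      (N m : ℝ) = ∑ m ∈ A, (N m : ℝ) := by rw [hA]
  rw [← hsplit1, ← hsplit2, hA_eq]
  linarith [htail, hWr, hA_sum]

end Summit.QuantumAdvantage.AdviceFreeQNC0
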